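import Literature.Geometry.Kaehler.ComplexTorusTotalLieAlgebraRatGrading
import HarnessLib

/-!
# `f_η ∈ 𝔤_tot(X; ℚ)₋₂` for every RATIONAL non-degenerate `2`-form `η`, of any Hodge type: the partial map
# `f : H²(X; ℚ) ⇢ 𝔤_tot(X; ℚ)₋₂` of the Lefschetz triple `(𝔤_tot(X), h, H²(X))` on the rational points, and
# "`Λ_η` is defined over `ℚ`" without a type-`(1,1)` hypothesis (Looijenga–Lunts 1997, §1 (1.1), (1.7), (1.9), §3 proof of (3.3))

Layer `Literature/Geometry/Kaehler`, namespace `Literature.Geometry.Kaehler.ComplexTorus`; lane `lit-hodgefound` (Track 2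
foundations library, Layer A: Hodge theory of complex tori on invariant forms), skeleton seat `lit-hodgefound-skel-1`
(generation 37), row **A1-81** of `run/shared/lean/pub/lit-hodgefound/SKELETON.md`.  A sequel BY NAME (nothing restated) of
rows A1-53 (`ComplexTorusNeronSeveriLieBracket`: the inverse `κ⁻¹ = sharp hnd : V^* → V` of the flat map of a non-degenerate
real `2`-form and **`spinorRepLin_lowEnd_sharp` — `f_κ = ρ(ψ₋₂(κ⁻¹))`**), A1-45 (`ComplexTorusHalfSpinWeights`: the root vectors
`Z_{k,l} = ψ₋₂(v_l ∧ v_k)` of a real basis and `lowEnd_eq_sum_rootZ` — `ψ₋₂(P) = ½ ∑_{l,k} θ^k(P θ^l) Z_{k,l}`), A1-60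
(`ComplexTorusNeronSeveriLieAlgebraDefinedOverQ`: `rationalEnd Φ = 𝔤𝔩(H•(X; ℚ))`; there `lefschetzDualG_mem_rationalEnd_of_isNSForm`
needs `η ∈ NS(X)`, i.e. TYPE `(1,1)`), A1-71 (`ComplexTorusTotalLieAlgebraDefinedOverQ`: `𝔤_tot(X; ℚ)`; its
`lefschetzDualG_mem_totalLieAlgebraRat` again needs type `(1,1)`), A1-75 (`ComplexTorusTotalLieAlgebraRatGrading`: the piece
`𝔤_tot(X; ℚ)₋₂ = totalLieAlgebraRatDeg Φ (-2) ∋ i_{λᵢ}i_{λⱼ}`) and A2/A4 (`ComplexTorusPolarizationType`: the Gram matrix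
`latticeGram Φ η = (η(λ_a, λ_b))_{a,b}`; `ComplexTorusDualAbelianVariety`: `det_latticeGram_ne_zero`; `ComplexTorusLefschetzDual`:
`Λ_η = lefschetzDual η`, rational on `H•(X; ℚ)` for `η ∈ NS(X)` only, `lefschetzDual_mem_rationalForms`).
THEOREMS ONLY: no definition, no instance, no local instance attribute, no named fact, no `sorry` (D-0026 net debt `0`).

## Sources, VERBATIM

E. Looijenga, V. A. Lunts, *A Lie algebra attached to a projective variety*, Invent. Math. **129** (1997) 361–412 (held
text `paper:arxiv-alg-geom_9604014`; page/line numbers of that text):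

> (§1, Lefschetz triples, p0007 L55–L66) "a semisimple Lie algebra `𝔤`, a simple element `h ∈ 𝔤` […] and an abelian
> subalgebra `𝔞` of `𝔤` such that **(i) the adjoint representation of `𝔤` makes `𝔤` a Lefschetz module over `𝔞`, i.e.,
> there is a rational map `f : 𝔞 → 𝔤₋₂` so that for `e` in the domain of `f`, we have an `𝔰𝔩(2)`-triple `(e, h, f_e)`** and
> (ii) `𝔤` is as a Lie algebra generated by `𝔞` and the image of `f`."
> (§1 (1.7), p0006 L60–L66) "if `M` and the action of `𝔞` on `M` are defined over a subfield `K` of `ℂ`, then so is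
> `𝔤(𝔞, M)`"; (§1 (1.9), p0006 L119–L122) "we often write `𝔤_*(X; K)` for the corresponding Lie algebra of `K`-points."
> (§3, proof of (3.3), p0013 L92–L107) "Suppose `κ` is a nondegenerate `2`-form on `V`. Then there exist a basis
> `(a_{±1}, …, a_{±n})` such that `κ = ∑_{k=1}^n α_{-k} ∧ α_k`. […] it follows that **`f_κ` is defined and equal to
> `∑_{k=1}^n i_{a_{-k}} i_{a_k}`**. The nondegenerate `2`-forms make up a nonempty open subset of `⋀²V^*` […]. The
> corresponding `2`-vectors form an open subset of `⋀²V` and so `𝔤_tot(X)` is generated by `𝔤₂ ⊕ 𝔤₋₂` as a Lie algebra."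

C. Voisin, *Hodge Theory and Complex Algebraic Geometry I* (Cambridge, 2002), §6.2.1 Lemma 6.19 (`Λ = *⁻¹L*`, the
`𝔰𝔩₂`-partner of `L`) and §7.1.2 (for a RATIONAL Kähler class the operators `L`, `Λ` and the Lefschetz decomposition are
defined over `ℚ`) — the statement generalised here from Kähler/Néron–Severi classes to every rational non-degenerate `2`-form.

## Dictionary

`X = E/Φ(ℤ^ι)` (`g = dim_ℂ E`, `|ι| = 2g`), lattice basis `λ_a = periodBasis Φ a = Φ(e_a)`, dual lattice coordinates
`dx_a = latticeDx Φ a` (`dx_a(λ_b) = δ_{ab}`); `H•(X; ℂ) = GForm E ℂ`, `Hᵏ(X; ℚ) = rationalForms Φ k`; for a real `2`-form `η`: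
`e_η = lefschetzG η` (`= ρψ₂(η)`), `f_η = Λ_η = lefschetzDualG η` (degree-wise `lefschetzDual η m`), `η♭ = flat η : V → V^*`,
`η⁻¹ = sharp hnd : V^* → V` (`hnd` = non-degeneracy), Gram matrix `G = latticeGram Φ η`, `G_{ab} = η(λ_a, λ_b)`; `𝔤_tot(X; ℚ) =
totalLieAlgebraRat Φ`, `𝔤_tot(X; ℚ)₋₂ = totalLieAlgebraRatDeg Φ (-2)`, `𝔤𝔩(H•(X; ℚ)) = rationalEnd Φ`.  "`η` rational" means
`ofRealForm η ∈ rationalForms Φ 2`, equivalently `G ∈ Mat_ι(ℚ)` (`exists_map_ratCast_eq_latticeGram`).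

## What is formalised (all `theorem`s, proved)

* §1 THE RATIONAL INVERSE: `coordCLM_periodBasis` (the coframe of the lattice basis is `(dx_a)`),
  `exists_map_ratCast_eq_latticeGram` (a rational `η` has a rational Gram matrix `G₀`), `isUnit_det_of_map_ratCast_eq_latticeGram`
  (non-degenerate ⇒ `det G₀ ≠ 0`), `flat_periodBasis_periodBasis` (`η♭(λ_a)(λ_b) = G_{ab}`), `sum_ratCast_inv_mul_latticeGram`
  (`(G₀⁻¹ ⊗ ℝ)·G = 1`), **`sharp_latticeDx_eq_sum` —
  `η⁻¹(dx_l) = ∑_a (G₀⁻¹)_{la} λ_a`** and **`latticeDx_sharp_latticeDx` — `dx_k(η⁻¹ dx_l) = (G₀⁻¹)_{lk} ∈ ℚ`**: the `2`-vector `η⁻¹`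
  dual to a rational non-degenerate `2`-form is rational.
* §2 **`lefschetzDualG_eq_sum` — `f_η = ½ ∑_{l,k} (G₀⁻¹)_{lk} · i_{λ_l} i_{λ_k}`** (LL's "`f_κ = ∑ i_{a_{-k}} i_{a_k}`" in the LATTICE
  basis instead of a symplectic one: `f_η = ρψ₋₂(η⁻¹)` expanded in the root vectors `Z_{k,l} = ψ₋₂(λ_l ∧ λ_k)`), hence
  **`lefschetzDualG_mem_totalLieAlgebraRatDeg_negTwo` — `f_η ∈ 𝔤_tot(X; ℚ)₋₂` FOR EVERY RATIONAL NON-DEGENERATE REAL `2`-FORM `η`,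
  OF ANY TYPE** (rows A1-60/A1-71 proved `f_η ∈ 𝔤_tot(X; ℚ)` only for `η ∈ NS(X) ⊗ ℚ`, i.e. of type `(1,1)`, through a
  rational symplectic frame); `lefschetzDualG_mem_totalLieAlgebraRat'`, **`lefschetzDualG_mem_rationalEnd'` — `Λ_η ∈ 𝔤𝔩(H•(X; ℚ))`** (row A1-60's
  `lefschetzDualG_mem_rationalEnd` needs `η ∈ NS(X) ⊗ ℚ`),
  **`lefschetzDual_mem_rationalForms'` — `Λ_η(H^{m+2}(X; ℚ)) ⊆ Hᵐ(X; ℚ)`** (Voisin §7.1.2 "`Λ` is defined over `ℚ`", now for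
  every rational non-degenerate `η`), and the Lefschetz-triple clause (i) on rational points: `lefschetzTriple_mem_totalLieAlgebraRatDeg`
  (`e_η ∈ 𝔤_tot(X; ℚ)₂`, `h ∈ 𝔤_tot(X; ℚ)₀`, `f_η ∈ 𝔤_tot(X; ℚ)₋₂` with `[e_η, f_η] = h`, `[h, e_η] = 2e_η`, `[h, f_η] = -2f_η` —
  rows A1-41's `lie_lefschetzG_lefschetzDualG`, `lie_countingG_lefschetzG`, `lie_countingG_lefschetzDualG`, recalled).
* §3 VALIDATION (Layer-A referee): `lefschetzDualG_mem_totalLieAlgebraRatDeg_negTwo_of_isRiemannForm` (a polarisation: the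
  type-`(1,1)` case of rows A1-60/A1-71 is recovered), and the `2 × 2` bookkeeping `latticeDx_sharp_latticeDx` read on the
  coefficient level: `sum_latticeDx_sharp_mul_latticeGram` (`∑_k dx_k(η⁻¹dx_l) G_{kb} = δ_{lb}`: the coefficient matrix IS `G⁻¹`).

## Proof sketch

`η♭(λ_a) = ∑_b G_{ab} dx_b`, so `η♭(∑_a c_a λ_a) = dx_l` iff `cG = e_l` iff `c = e_l G⁻¹`; with `G = G₀` rational and
`det G₀ ≠ 0` (`det_latticeGram_ne_zero`, row A2) this gives `η⁻¹(dx_l) = ∑_a (G₀⁻¹)_{la} λ_a` with RATIONAL coefficients.  Row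
A1-45's expansion `ψ₋₂(P) = ½ ∑_{l,k} dx_k(P dx_l) Z_{k,l}` (coframe `dx` of the lattice basis) and row A1-53's `f_η = ρψ₋₂(η⁻¹)`
then give `f_η = ½ ∑ (G₀⁻¹)_{lk} ρ(Z_{k,l}) = ½ ∑ (G₀⁻¹)_{lk} i_{λ_l}i_{λ_k}`, a `ℚ`-combination of row A1-75's generators of
`𝔤_tot(X; ℚ)₋₂`.

## SCOPE (what is NOT claimed)

(a) Non-degeneracy of `η` is assumed (for degenerate `η`, `f_η` is not defined — the tree's `lefschetzDualG` then has the junk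
value `0`); rationality is `ofRealForm η ∈ rationalForms Φ 2`.  (b) Only clause (i) of the Lefschetz triple (the partial map
`f` on rational points) and the `ℚ`-rationality of `Λ_η`; that the non-degenerate rational `η` are Zariski-dense in `H²(X; ℚ)`,
that their `f_η` span `𝔤_tot(X; ℚ)₋₂`, and "saturated" are NOT proved here (generation by `𝔤₂(ℚ) ∪ 𝔤₋₂(ℚ)` is row A1-79, the
abelian part `𝔤₂(ℚ) ≅ H²(X; ℚ)` is row A1-80).  (c) No Hodge-type hypothesis and no positivity: `η` need not be a
polarisation, `X` need not be algebraic.  (d) Nothing about `𝔤_NS`, `𝔤_K`, `𝔤_MT`.  (e) Nothing in this file is a case of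
the Hodge conjecture.

## References

* [LooijengaLunts1997] E. Looijenga, V. A. Lunts, *A Lie algebra attached to a projective variety*, Invent. Math. 129 (1997)
  361–412; arXiv:alg-geom/9604014. §1 (1.1), (1.7), (1.9); §3 (3.1)–(3.3) and the proof of (3.3) (held
  `paper:arxiv-alg-geom_9604014`, p0006–p0007, p0012–p0013).
* [Voisin2002] C. Voisin, *Hodge Theory and Complex Algebraic Geometry I*, Cambridge Studies in Advanced Mathematics 76
  (2002), §6.2.1 Lemma 6.19, §7.1.2.
* [Lange2023AbelianVarietiesComplex] H. Lange, *Abelian Varieties over the Complex Numbers*, Springer (2023), §1.1.4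
  Prop. 1.1.20 (`dx_a(λ_b) = δ_{ab}`), §1.5.1 (the matrix of a form on a lattice basis).
* [FultonHarris1991] W. Fulton, J. Harris, *Representation Theory. A First Course*, GTM 129, Springer (1991), §18.1 (the
  root vectors `Z_{i,j}` of `𝔰𝔬_{2n}`).
-/

noncomputable section

-- `Module ℚ` / `Module ℂ` synthesis on `E [⋀^Fin k]→L[ℝ] ℂ`, as in the parent files
set_option maxSynthPendingDepth 3

open Module Function
open scoped Matrix
open Literature.LinearAlgebra.Alternating
open Literature.LinearAlgebra.Alternating.GForm (of intC of_apply_self)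

namespace Literature.Geometry.Kaehler

namespace ComplexTorus

/-! ### §1 The rational inverse `η⁻¹` of a rational non-degenerate `2`-form -/

section RationalInverse

variable {ι : Type*} [Fintype ι] [DecidableEq ι] {E : Type*} [NormedAddCommGroup E] [NormedSpace ℂ E]
  (Φ : (ι → ℝ) ≃L[ℝ] E)

/-- A `2`-form is determined by its values on the literal pairs `![u, v]`. [folklore] -/
private theorem twoForm_apply_eq_vecCons' {F : Type*} [NormedAddCommGroup F] [NormedSpace ℝ F]
    (γ : E [⋀^Fin 2]→L[ℝ] F) (v : Fin 2 → E) : γ v = γ ![v 0, v 1] := by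
  congr 1; funext i; fin_cases i <;> rfl

omit [DecidableEq ι] in
/-- **The coframe of the lattice basis is `(dx_a)`**: `θ^a = dx_a` for `b = (λ_a) = periodBasis Φ`.
[cite: Lange2023AbelianVarietiesComplex, §1.1.4 Prop. 1.1.20] -/
theorem coordCLM_periodBasis [FiniteDimensional ℂ E] (k : ι) : coordCLM E (periodBasis Φ) k = latticeDx Φ k := by
  ext x
  change (periodBasis Φ).coord k x = Φ.symm x k
  simp [periodBasis]

/-- **A rational `2`-form has a rational Gram matrix on the lattice basis**: `G = G₀ ⊗ ℝ` with `G₀ ∈ Mat_ι(ℚ)`.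
[cite: Lange2023AbelianVarietiesComplex, §1.5.1] [cite: LooijengaLunts1997, §1 (1.7)] -/
theorem exists_map_ratCast_eq_latticeGram {η : E [⋀^Fin 2]→L[ℝ] ℝ} (hη : ofRealForm η ∈ rationalForms Φ 2) :
    ∃ G₀ : Matrix ι ι ℚ, G₀.map ((↑) : ℚ → ℝ) = latticeGram Φ η := by
  have h : ∀ a b : ι, ∃ q : ℚ, η ![Φ (Pi.single a 1), Φ (Pi.single b 1)] = q := fun a b ↦ by
    obtain ⟨q, hq⟩ := hη ![Pi.single a 1, Pi.single b 1]
    rw [twoForm_apply_eq_vecCons', ofRealForm_apply] at hq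
    simp only [latticeTuple_apply, Matrix.cons_val_zero, Matrix.cons_val_one, latticeVec_single] at hq
    exact ⟨q, by exact_mod_cast hq⟩
  choose G hG using h
  refine ⟨Matrix.of fun a b ↦ G a b, ?_⟩
  ext a b
  rw [Matrix.map_apply, Matrix.of_apply, latticeGram_apply, hG]

/-- **A rational Gram matrix of a NON-DEGENERATE form is invertible over `ℚ`** (`det G₀ ≠ 0`, row A2's
`det_latticeGram_ne_zero`). [cite: Lange2023AbelianVarietiesComplex, §1.5.1 and Prop. 1.4.7] -/
theorem isUnit_det_of_map_ratCast_eq_latticeGram {η : E [⋀^Fin 2]→L[ℝ] ℝ} (hnd : ∀ v : E, v ≠ 0 → ∃ w : E, η ![v, w] ≠ 0)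
    {G₀ : Matrix ι ι ℚ} (hG₀ : G₀.map ((↑) : ℚ → ℝ) = latticeGram Φ η) : IsUnit G₀.det := by
  rw [isUnit_iff_ne_zero]
  intro h0
  refine det_latticeGram_ne_zero Φ (η := η) (fun u hu ↦ ?_) ?_
  · by_contra hne
    obtain ⟨w, hw⟩ := hnd u hne
    exact hw (hu w)
  · have e : (G₀.map ((↑) : ℚ → ℝ)).det = ((G₀.det : ℚ) : ℝ) := by
      rw [← Rat.coe_castHom, ← RingHom.mapMatrix_apply, ← RingHom.map_det]
    rw [← hG₀, e, h0, Rat.cast_zero]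

variable [FiniteDimensional ℂ E]

/-- `η♭(λ_a)(λ_b) = η(λ_a, λ_b) = G_{ab}`. [cite: Lange2023AbelianVarietiesComplex, §1.5.1] -/
theorem flat_periodBasis_periodBasis (η : E [⋀^Fin 2]→L[ℝ] ℝ) (a b : ι) :
    flat η (periodBasis Φ a) (periodBasis Φ b) = latticeGram Φ η a b := by
  rw [flat_apply, latticeGram_apply, periodBasis_apply, periodBasis_apply]

omit [FiniteDimensional ℂ E] in
/-- `(G₀⁻¹ ⊗ ℝ) · G = 1` entrywise: `∑_a (G₀⁻¹)_{la} G_{ab} = δ_{lb}` for the rational Gram matrix of a non-degenerate form.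
[cite: Lange2023AbelianVarietiesComplex, §1.5.1] -/
theorem sum_ratCast_inv_mul_latticeGram {η : E [⋀^Fin 2]→L[ℝ] ℝ} (hnd : ∀ v : E, v ≠ 0 → ∃ w : E, η ![v, w] ≠ 0)
    {G₀ : Matrix ι ι ℚ} (hG₀ : G₀.map ((↑) : ℚ → ℝ) = latticeGram Φ η) (l b : ι) :
    ∑ a, ((G₀⁻¹ l a : ℚ) : ℝ) * latticeGram Φ η a b = if l = b then 1 else 0 := by
  have h1 : (G₀⁻¹).map ((↑) : ℚ → ℝ) * latticeGram Φ η = 1 := by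
    rw [← hG₀, ← Rat.coe_castHom, ← RingHom.mapMatrix_apply, ← RingHom.mapMatrix_apply, ← map_mul,
      Matrix.nonsing_inv_mul G₀ (isUnit_det_of_map_ratCast_eq_latticeGram Φ hnd hG₀), map_one]
  have h := congrFun (congrFun h1 l) b
  rwa [Matrix.mul_apply, Matrix.one_apply] at h

/-- **`η⁻¹(dx_l) = ∑_a (G₀⁻¹)_{la} λ_a`**: the inverse of the flat map of a rational non-degenerate `2`-form, on the dual
lattice coordinates, in terms of the inverse of its rational Gram matrix (`η♭(λ_a) = ∑_b G_{ab} dx_b`).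
[cite: LooijengaLunts1997, §3 proof of (3.3)] [cite: Lange2023AbelianVarietiesComplex, §1.5.1] -/
theorem sharp_latticeDx_eq_sum {η : E [⋀^Fin 2]→L[ℝ] ℝ} (hnd : ∀ v : E, v ≠ 0 → ∃ w : E, η ![v, w] ≠ 0)
    {G₀ : Matrix ι ι ℚ} (hG₀ : G₀.map ((↑) : ℚ → ℝ) = latticeGram Φ η) (l : ι) :
    sharp hnd (latticeDx Φ l) = ∑ a, ((G₀⁻¹ l a : ℚ) : ℝ) • periodBasis Φ a := by
  apply flat_injective hnd
  rw [flat_sharp]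
  refine ContinuousLinearMap.coe_injective ((periodBasis Φ).ext fun b ↦ ?_)
  simp only [ContinuousLinearMap.coe_coe, map_sum, map_smul, _root_.sum_apply, _root_.smul_apply,
    flat_periodBasis_periodBasis, latticeDx_periodBasis, smul_eq_mul]
  rw [sum_ratCast_inv_mul_latticeGram Φ hnd hG₀, Pi.single_apply]

/-- **`dx_k(η⁻¹ dx_l) = (G₀⁻¹)_{lk} ∈ ℚ`: the `2`-vector `η⁻¹ ∈ ⋀²V` dual to a rational non-degenerate `2`-form is RATIONAL**
(its coefficients on `λ_l ∧ λ_k` are the entries of the inverse Gram matrix). [cite: LooijengaLunts1997, §1 (1.7), §3 proof of (3.3)] -/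
theorem latticeDx_sharp_latticeDx {η : E [⋀^Fin 2]→L[ℝ] ℝ} (hnd : ∀ v : E, v ≠ 0 → ∃ w : E, η ![v, w] ≠ 0)
    {G₀ : Matrix ι ι ℚ} (hG₀ : G₀.map ((↑) : ℚ → ℝ) = latticeGram Φ η) (k l : ι) :
    latticeDx Φ k (sharp hnd (latticeDx Φ l)) = ((G₀⁻¹ l k : ℚ) : ℝ) := by
  rw [sharp_latticeDx_eq_sum Φ hnd hG₀, map_sum]
  simp only [map_smul, latticeDx_periodBasis, smul_eq_mul, Pi.single_apply, mul_ite, mul_one, mul_zero,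
    Finset.sum_ite_eq, Finset.mem_univ, if_true]

/-- **VALIDATION of the bookkeeping: `∑_k dx_k(η⁻¹ dx_l) · G_{kb} = δ_{lb}`** for EVERY non-degenerate real `2`-form — the
coefficient matrix of `η⁻¹` on the lattice basis IS the inverse Gram matrix (`η(η⁻¹ξ, y) = ξ(y)` on `ξ = dx_l`, `y = λ_b`),
independently of the rational bookkeeping above. [cite: LooijengaLunts1997, §3 (3.5) (proof)] -/
theorem sum_latticeDx_sharp_mul_latticeGram {η : E [⋀^Fin 2]→L[ℝ] ℝ} (hnd : ∀ v : E, v ≠ 0 → ∃ w : E, η ![v, w] ≠ 0)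
    (l b : ι) : ∑ k, latticeDx Φ k (sharp hnd (latticeDx Φ l)) * latticeGram Φ η k b = if l = b then 1 else 0 := by
  have key : η ![sharp hnd (latticeDx Φ l), periodBasis Φ b] = if l = b then 1 else 0 := by
    rw [twoForm_sharp_left, latticeDx_periodBasis, Pi.single_apply]
  rw [← key, ← flat_apply]
  conv_rhs => rw [← sum_coordCLM_smul E (periodBasis Φ) (sharp hnd (latticeDx Φ l))]
  simp only [map_sum, map_smul, _root_.sum_apply, _root_.smul_apply, flat_periodBasis_periodBasis, smul_eq_mul,
    coordCLM_periodBasis]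

end RationalInverse

/-! ### §2 `f_η = ½ ∑ (G₀⁻¹)_{lk} i_{λ_l} i_{λ_k} ∈ 𝔤_tot(X; ℚ)₋₂` and "`Λ_η` is defined over `ℚ`" -/

section DualLefschetz

variable {ι : Type*} [Fintype ι] [DecidableEq ι] {E : Type*} [NormedAddCommGroup E] [NormedSpace ℂ E]
  [FiniteDimensional ℂ E] [Nontrivial E] (Φ : (ι → ℝ) ≃L[ℝ] E)

/-- **`f_η = ½ ∑_{l,k} (G₀⁻¹)_{lk} · i_{λ_l} i_{λ_k}`** for a non-degenerate real `2`-form with rational Gram matrix `G₀` —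
Looijenga–Lunts' "`f_κ` is defined and equal to `∑ i_{a_{-k}} i_{a_k}`" written in the LATTICE basis (`f_κ = ρψ₋₂(κ⁻¹)`,
row A1-53, expanded in the root vectors `Z_{k,l} = ψ₋₂(λ_l ∧ λ_k)`, `ρ(Z_{k,l}) = i_{λ_l}i_{λ_k}`, row A1-45).
[cite: LooijengaLunts1997, §3 proof of (3.3)] [cite: FultonHarris1991, §18.1] -/
theorem lefschetzDualG_eq_sum {η : E [⋀^Fin 2]→L[ℝ] ℝ} (hnd : ∀ v : E, v ≠ 0 → ∃ w : E, η ![v, w] ≠ 0)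
    {G₀ : Matrix ι ι ℚ} (hG₀ : G₀.map ((↑) : ℚ → ℝ) = latticeGram Φ η) :
    lefschetzDualG η = (1 / 2 : ℝ) • ∑ l, ∑ k, ((G₀⁻¹ l k : ℚ) : ℝ) • (intC (periodBasis Φ l) * intC (periodBasis Φ k)) := by
  rw [← spinorRepLin_lowEnd_sharp hnd, lowEnd_eq_sum_rootZ (periodBasis Φ) (sharp_skew hnd), map_smul]
  simp only [map_sum, map_smul, spinorRepLin_rootZ, coordCLM_periodBasis, latticeDx_sharp_latticeDx Φ hnd hG₀]

/-- **`f_η ∈ 𝔤_tot(X; ℚ)₋₂` FOR EVERY RATIONAL NON-DEGENERATE REAL `2`-FORM `η`, OF ANY TYPE** — the partial map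
`f : 𝔞 = H²(X; ℚ) ⇢ 𝔤_tot(X; ℚ)₋₂` of the Lefschetz triple `(𝔤_tot(X; ℚ), h, H²(X; ℚ))` on its domain (rows A1-60/A1-71 had it
for `η ∈ NS(X) ⊗ ℚ` only). [cite: LooijengaLunts1997, §1 (1.1) (i), (1.7), (1.9), §3 proof of (3.3)] -/
theorem lefschetzDualG_mem_totalLieAlgebraRatDeg_negTwo {η : E [⋀^Fin 2]→L[ℝ] ℝ} (hη : ofRealForm η ∈ rationalForms Φ 2)
    (hnd : ∀ v : E, v ≠ 0 → ∃ w : E, η ![v, w] ≠ 0) : lefschetzDualG η ∈ totalLieAlgebraRatDeg Φ (-2) := by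
  obtain ⟨G₀, hG₀⟩ := exists_map_ratCast_eq_latticeGram Φ hη
  rw [lefschetzDualG_eq_sum Φ hnd hG₀, show (1 / 2 : ℝ) = ((1 / 2 : ℚ) : ℝ) by push_cast; ring, Rat.cast_smul_eq_qsmul]
  refine Submodule.smul_mem _ _ (Submodule.sum_mem _ fun l _ ↦ Submodule.sum_mem _ fun k _ ↦ ?_)
  rw [Rat.cast_smul_eq_qsmul]
  exact Submodule.smul_mem _ _ (intC_mul_intC_mem_totalLieAlgebraRatDeg_negTwo Φ l k)

/-- **`f_η ∈ 𝔤_tot(X; ℚ)`** for every rational non-degenerate real `2`-form `η` (row A1-71's `lefschetzDualG_mem_totalLieAlgebraRat`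
without its type-`(1,1)` hypothesis). [cite: LooijengaLunts1997, §1 (1.1), (1.9), §3 (3.3)] -/
theorem lefschetzDualG_mem_totalLieAlgebraRat' {η : E [⋀^Fin 2]→L[ℝ] ℝ} (hη : ofRealForm η ∈ rationalForms Φ 2)
    (hnd : ∀ v : E, v ≠ 0 → ∃ w : E, η ![v, w] ≠ 0) : lefschetzDualG η ∈ totalLieAlgebraRat Φ :=
  totalLieAlgebraRatDeg_le Φ (-2) (lefschetzDualG_mem_totalLieAlgebraRatDeg_negTwo Φ hη hnd)

/-- **`Λ_η ∈ 𝔤𝔩(H•(X; ℚ))`: the dual Lefschetz operator of a rational non-degenerate `2`-form is a RATIONAL operator**,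
whatever the Hodge type of `η` (row A1-60's `lefschetzDualG_mem_rationalEnd_of_isNSForm` assumed `η ∈ NS(X)`).
[cite: Voisin2002, §7.1.2] [cite: LooijengaLunts1997, §1 (1.7)] -/
theorem lefschetzDualG_mem_rationalEnd' {η : E [⋀^Fin 2]→L[ℝ] ℝ} (hη : ofRealForm η ∈ rationalForms Φ 2)
    (hnd : ∀ v : E, v ≠ 0 → ∃ w : E, η ![v, w] ≠ 0) : lefschetzDualG η ∈ rationalEnd Φ :=
  mem_rationalEnd_of_mem_totalLieAlgebraRat Φ (lefschetzDualG_mem_totalLieAlgebraRat' Φ hη hnd)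

/-- **"`Λ` IS DEFINED OVER `ℚ`" FOR EVERY RATIONAL NON-DEGENERATE `2`-FORM: `Λ_η(H^{m+2}(X; ℚ)) ⊆ Hᵐ(X; ℚ)`** (row A4's
`lefschetzDual_mem_rationalForms` assumed `η ∈ NS(X)`; here no type condition and no positivity).
[cite: Voisin2002, §6.2.1 Lemma 6.19, §7.1.2] [cite: LooijengaLunts1997, §1 (1.7)] -/
theorem lefschetzDual_mem_rationalForms' {η : E [⋀^Fin 2]→L[ℝ] ℝ} (hη : ofRealForm η ∈ rationalForms Φ 2)
    (hnd : ∀ v : E, v ≠ 0 → ∃ w : E, η ![v, w] ≠ 0) {m : ℕ} {γ : E [⋀^Fin (m + 2)]→L[ℝ] ℂ}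
    (hγ : γ ∈ rationalForms Φ (m + 2)) : lefschetzDual η m γ ∈ rationalForms Φ m := by
  have h := (mem_rationalFormsG_iff Φ).1
    ((mem_rationalEnd_iff Φ).1 (lefschetzDualG_mem_rationalEnd' Φ hη hnd) _ (of_mem_rationalFormsG Φ hγ)) m
  rwa [lefschetzDualG_apply, of_apply_self] at h

/-- **Clause (i) of the Lefschetz triple `(𝔤_tot(X; ℚ), h, H²(X; ℚ))` on the rational points**: for a rational `η` in the
domain of `f` (non-degenerate), `e_η ∈ 𝔤_tot(X; ℚ)₂`, `h ∈ 𝔤_tot(X; ℚ)₀`, `f_η ∈ 𝔤_tot(X; ℚ)₋₂`, and `(e_η, h, f_η)` is an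
`𝔰𝔩₂`-triple: `[e_η, f_η] = h`, `[h, e_η] = 2e_η`, `[h, f_η] = -2f_η` (the relations are rows A1-41's, recalled).
[cite: LooijengaLunts1997, §1 (1.1) (i), (1.9), §3 (3.3)] -/
theorem lefschetzTriple_mem_totalLieAlgebraRatDeg {η : E [⋀^Fin 2]→L[ℝ] ℝ} (hη : ofRealForm η ∈ rationalForms Φ 2)
    (hnd : ∀ v : E, v ≠ 0 → ∃ w : E, η ![v, w] ≠ 0) :
    (lefschetzG η ∈ totalLieAlgebraRatDeg Φ 2 ∧ countingG E ∈ totalLieAlgebraRatDeg Φ 0 ∧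
        lefschetzDualG η ∈ totalLieAlgebraRatDeg Φ (-2)) ∧
      ⁅lefschetzG η, lefschetzDualG η⁆ = countingG E ∧ ⁅countingG E, lefschetzG η⁆ = 2 • lefschetzG η ∧
        ⁅countingG E, lefschetzDualG η⁆ = -(2 • lefschetzDualG η) := by
  refine ⟨⟨?_, ?_, lefschetzDualG_mem_totalLieAlgebraRatDeg_negTwo Φ hη hnd⟩, lie_lefschetzG_lefschetzDualG hnd,
    lie_countingG_lefschetzG η, lie_countingG_lefschetzDualG η⟩
  · exact (mem_totalLieAlgebraRatDeg_iff Φ).2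
      ⟨(mem_totalLieAlgebraRat_iff Φ).2 ⟨lefschetzG_mem_totalLieAlgebra' η, lefschetzG_mem_rationalEnd Φ hη⟩, by
        rw [lie_countingG_lefschetzG, two_smul, two_smul]⟩
  · exact (mem_totalLieAlgebraRatDeg_iff Φ).2 ⟨countingG_mem_totalLieAlgebraRat Φ, by rw [Ring.lie_def, sub_self, zero_smul]⟩

/-! ### §3 Validation (Layer-A referee): a polarisation recovers the type-`(1,1)` case -/

/-- **VALIDATION (a polarised torus / abelian variety): for a Riemann form `η` — integral, type `(1,1)`, positive, hence
rational and non-degenerate — `f_η ∈ 𝔤_tot(X; ℚ)₋₂`**, consistent with rows A1-60/A1-71 (which reach `f_η ∈ 𝔤_tot(X; ℚ)`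
through a rational symplectic frame of the `(1,1)`-form). [cite: LooijengaLunts1997, §3 (3.3), (3.5)] -/
theorem lefschetzDualG_mem_totalLieAlgebraRatDeg_negTwo_of_isRiemannForm {η : E [⋀^Fin 2]→L[ℝ] ℝ}
    (hη : IsRiemannForm Φ η) : lefschetzDualG η ∈ totalLieAlgebraRatDeg Φ (-2) :=
  lefschetzDualG_mem_totalLieAlgebraRatDeg_negTwo Φ (hη.isNSForm.ofRealForm_mem_rationalForms Φ) fun v hv ↦ by
    by_contra h
    exact hv (hη.nondegenerate v fun w ↦ of_not_not fun hw ↦ h ⟨w, hw⟩)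

end DualLefschetz

end ComplexTorus

end Literature.Geometry.Kaehler
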